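import Summits.ResolutionOfSingularities.ResolutionOfSingularities.Theses.UniversalCells
import Literature.AlgebraicGeometry.Resolution.PrincipalizationToResolution
import Literature.AlgebraicGeometry.Resolution.CanonicalResolutionProofs
import Summits.ResolutionOfSingularities.ResolutionOfSingularities.Theorems.FrobeniusLadderFRationalResolutionAffineSpaceResolution

/-!
# Disproof of `ProductDescent` (crux stmt-ResolutionOfSingularities-15231, route `UniversalCells`,
# rank 3) — findings of the crux-disprover (cdisprove), cycles 1–3, 2026-08-17

Crux (route decl, fixed): for `Y` integral separated of finite type over `𝔽_p = ZMod p`,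
`s ∈ ℕ`, `j : W ↪ 𝔸ˢ_Y` an open immersion, `w ∈ W` over `y ∈ Y`:
UPSTAIRS(w) := "`w` has an open neighbourhood `W' ⊆ W` with a resolution" implies
DOWNSTAIRS(y) := "`y` has an open neighbourhood `U ⊆ Y` with a resolution".

VERDICT OF CYCLE 1: **no kill of the crux is possible below the summit** (§1), one registered
stub of the lead's line `birth` (rev L5) is **false as stated** (§3, landed), the other stubs
are true on paper (§3), and the degenerate regimes all satisfy the crux outright (§2).
VERDICT OF CYCLE 2: the load-bearing stub `stub_verticalLines` of the adopted line `vertical-lines`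
is **FALSE on paper** (§4b: `Z = Bl_C Bl_L 𝔸⁴` over the regular `Y = 𝔸³`, char-free; crux untouched;
the line card's fallback survives the witness).
VERDICT OF CYCLE 3 (gen 2, after the lead's `KERNEL.md`): both lines are gone (`birth` parked on its
no-slack core, `vertical-lines` dead twice — §4b and the lead's rotating pencil, whose algebraic
core is kernel-checked in §4c); nothing refutable is left standing except the untyped ENGINE
"canonical flatteners of regular `Z̄` are regular" (M2), for which NO witness was found (§5c records
the search, a dim-2 structure result and a trap: the cycle-level/toric flattener can be singular
while the Hilbert flattener is regular); the existential fallback FB and the kernel (K) are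
sandwiched between `PrimeFieldThesis` and the crux (§5a) — irrefutable; §5b is the six-witness
GAUNTLET every future transport stub must pass. No new Negative/ lemma this cycle (nothing honest
left to land below the summit; p154986/p155579 still pending at the gate).
Landed / filed through the gate (Theorems/ProductDescent/Negative/): `StubSliceWiggleFalse.lean`
(p153659, ACCEPTED), `LoadBearing.lean` (p154986) and `SeparabilisationNoSlack.lean` (p155579:
`separabilisation_of_downstairs`, `stub_separabilisation_of_productDescent` — the open `birth`
stub follows from the crux's own conclusion, verbatim) — import those for the kernel-checked
statements; this workfile re-proves the short ones so that it is self-contained, and carries the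
paper analyses as docstrings.

## Findings

1. IRREFUTABLE MODULO THE TARGET (§1). DOWNSTAIRS(y) is implied by pointwise-local
   resolvability over `𝔽_p` (`LocRes`, the antecedent of `LocalToGlobal`), hence by the route
   target `PrimeFieldThesis`, hence by the summit; the upstairs datum only WEAKENS the crux.
   So `¬ ProductDescent → ¬ PrimeFieldThesis → ¬ ResolutionOfSingularities`
   (`not_primeFieldThesis_of_not_productDescent`, `not_summit_of_not_productDescent`). A
   counterexample is a prime `p`, an integral separated finite-type `𝔽_p`-scheme `Y` and a
   point `y` with NO resolvable open neighbourhood (plus a resolvable open upstairs): a failure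
   of LOCAL resolution in characteristic `p`, open from dimension 4. No finite model, degenerate
   regime, `kit` computation or barrier reduction can produce one; none was attempted beyond the
   degenerate instances of §2, which all hold.
2. DEGENERATE INSTANCES HOLD OUTRIGHT (§2; all kernel-checked in `LoadBearing.lean`, the first
   two re-proved here): `s = 0` (`𝔸⁰_Y ≅ Y`; NO hypothesis on `Y` needed); `y` regular, in
   particular `y = η_Y` (openness of `Reg` over a field, Matsumura 30.5 Cor., in tree);
   `dim Y ≤ 3` (Cossart–Piltant, vendored fact). Hence (`LoadBearing.not_productDescent_minimalCase`)
   a counterexample has `s ≥ 1`, `dim Y ≥ 4`, `y` a non-generic singular point. Moreover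
   DOWNSTAIRS(y) ⇒ UPSTAIRS(w) for every `s, W, j, w` over `y` (`LoadBearing.upstairs_of_downstairs`,
   via `hasResolution_affineSpace` in tree), so the crux is a PURE CONVERSE:
   `ProductDescent ↔ ∀ …, UPSTAIRS(w) ↔ DOWNSTAIRS(y)`.
3. LINE `birth` (rev L5, the `p`-th power section cut) — stub audit (§3).
   * `stub_sliceWiggle` — **FALSE as registered** (`stub_sliceWiggle_false`, landed p153659;
     re-proved below): nothing makes the birational model non-empty, `IsBirational (𝟙 ↑⊥)`
     holds, and at `V₁ = ⊥` the conclusion wants an open `Ω ≤ ⊥` containing `σ'(η_Y)`.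
     MISSTATED, not substantive. Repair: add the hypothesis
     `(AffineSpace.homOfVector V.ι (fun i => g i ^ p)).base ⟨y, hyV⟩ ∈ V₁` (the `hb` that
     `ProductDescent_proof` holds) or `Nonempty X₁`; the repaired stub is true on paper
     (docstring of `stub_sliceWiggle_false` below).
   * `stub_separabilisation` (the open core) — implied by DOWNSTAIRS(y) (take `V₁ = 𝔸ˢ_U`,
     `X₁ = 𝔸ˢ_Ũ` for a resolution `Ũ → U ∋ y`, `g = 0`; `Ũ` is regular of finite type over the
     PERFECT field `𝔽_p`, hence smooth, so `X₁ → 𝔸ˢ_{𝔽_p}` is smooth everywhere): irrefutable,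
     and with the true stubs it implies the crux — the line has NO SLACK
     (`stub_separabilisation` ⟺ crux, modulo true stubs and `upstairs_of_downstairs`).
     For a FIXED resolution it fails exactly as the lead says (non-smooth locus swallowing the
     fibre over `y`; or `(W')_y` without a `κ(y)`-point with `p`-th power coordinates).
   * `stub_pthPowerSliceAlgebra` (landed), `stub_componentsClopen` (landed),
     `stub_sliceResolution` (landed) — true; `stub_sliceRegular` (open) — TRUE on paper:
     `σ = (gᵢᵖ) : V → 𝔸ˢ_Y` is an immersion (section of the separated `𝔸ˢ_V → V`, then open),
     so `𝒪_{X_σ,z} = 𝒪_{X₁,x} ⧸ (tᵢ - gᵢᵖ)`; `x ∈ smoothLocus` (Mathlib: the stalk map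
     `𝒪_{𝔸ˢ,t(x)} → 𝒪_{X₁,x}` is formally smooth) makes `𝒪_{X₁,x}` formally smooth over
     `𝔽_p[t]` (localisation is formally étale), `tᵢ - gᵢᵖ ∈ 𝔪_x` because `z` exists, and
     `stub_pthPowerSliceAlgebra` applies; the locus of `b ∈ V₁` with `π⁻¹(b) ⊆ smoothLocus` is
     open since `π` is proper (closed) and `smoothLocus` is open (`LocallyOfFinitePresentation`).
     Degenerate probes: `X₁ = ∅` makes `stub_sliceRegular` vacuous (no `z`) and contradicts the
     hypotheses `σ(η) ∈ Ω`, `IsIso (π ∣_ Ω)` of `stub_sliceResolution`; no hypothesis on `Y` is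
     used by `stub_sliceRegular` (none is stated — consistent).
4. LOAD-BEARING HYPOTHESES OF THE CRUX (paper; nothing refutable, see §1):
   * upstairs datum `(s, W, j, w, W')` — decoration relative to the summit (finding 2);
   * `IsSeparated f`, `QuasiCompact f` — not load-bearing (local on `Y`: an affine open
     neighbourhood of `y` is separated and quasi-compact; pull `W` back to `𝔸ˢ` over it);
   * `IsIntegral Y` — `IsReduced` suffices (resolve the irreducible components through `y`,
     `hasResolution_of_irreducibleComponents` in tree); dropping it entirely gives NO witness:
     at a non-reduced point (`Spec 𝔽_p[ε]`) UPSTAIRS fails for every `s` (no non-empty open of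
     `𝔸ˢ_{𝔽_p[ε]}` is generically reduced, and a resolution is an iso over a dense open of a
     reduced scheme) — vacuous; a generically reduced `Y` is resolved through `Y_red`;
   * `LocallyOfFiniteType f` — the only hypothesis whose removal leaves the summit's scope.
     Witnesses examined and found VACUOUS (UPSTAIRS fails too): `Y = Spec 𝔽_p[X]⁺` (absolute
     integral closure; no resolution, in tree `AbsoluteIntegralClosureNoResolution`): the local
     ring of `𝔸ˢ_Y` at the generic point `ξ` of the fibre over `y` is the Gauss extension
     `V(t)` of the valuation ring `V = 𝒪_{Y,y}`, again a non-Noetherian valuation ring, and a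
     regular (Noetherian) local ring of a proper birational `X' → W' ∋ ξ` over `ξ` would have
     to dominate, hence equal, `V(t)`; `Y = Spec B`, `B` a one-dimensional Noetherian local
     domain with infinite normalisation (Nagata): `Spec B` has no resolution (a resolution would
     be finite = the normalisation, by the dimension formula and Zariski), and neither has
     `Spec B(t)` (normalisation commutes with the smooth base change `B → B[t]`, and finiteness
     descends along the faithfully flat `B → B(t)`), so UPSTAIRS fails at `ξ`. A genuine
     witness needs a Noetherian NON-EXCELLENT local domain `A` with `Spec A(t)` resolvable in a
     neighbourhood but `Spec A` not — I know none; not formalisable here.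
5. NATURAL STRENGTHENINGS (paper): "DOWNSTAIRS is witnessed by a CONSTANT slice `t = a ∈ 𝔽_pˢ`
   of the given resolution" is false (the planner's example, placed over a singular point as
   the lead notes: blow up `{t = uᵖ} ⊂ E × 𝔸¹` inside a resolution, `E` exceptional over `y`;
   every slice `t = a`, `a ∈ 𝔽̄_p`, acquires `w·v + (u - a^{1/p})ᵖ = 0`); "… by SOME section
   `t = g(y)`" survives this example (`t = u + x` works) — the line's `p`-th power sections are
   the sections whose differential vanishes, which is why they need the smooth locus
   (finding 3). Neither is formalisable at scheme level in this tree within a cycle (no blow-up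
   of a non-affine centre with computed charts); recorded, not landed.

## What provers should take from this file
* Do not look for slack in the hypotheses: the crux is exactly "local resolvability descends
  along `𝔸ˢ_Y → Y`", equivalent to its own conclusion given the summit; every proof must
  construct a resolution of a neighbourhood of a SINGULAR, NON-GENERIC `y` in dimension `≥ 4`
  from one upstairs with `s ≥ 1`.
* `stub_sliceWiggle` must be re-registered with the extra hypothesis before it can be proved.
-/

noncomputable section

-- single-problem summit: the doubled namespace component `ResolutionOfSingularities` is forced
set_option linter.dupNamespace false

open CategoryTheory CategoryTheory.Limits AlgebraicGeometry Literature.AlgebraicGeometry.Resolution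
open Summit.ResolutionOfSingularities.ResolutionOfSingularities.Theses.UniversalCells
  (ProductDescent PrimeFieldThesis)

namespace Summit.ResolutionOfSingularities.ResolutionOfSingularities.Cruxes.ProductDescent.Disproof

/-! ## §1 Irrefutability (load-bearing analysis of the crux as a whole) -/

/-- `ProductDescent` WITHOUT its upstairs hypothesis is pointwise-local resolvability over
`𝔽_p`; a refutation of the crux refutes it. ("Any disproof must disprove local resolution.")
[folklore] -/
theorem not_locRes_of_not_productDescent (h : ¬ ProductDescent) :
    ¬ ∀ p : ℕ, p.Prime → ∀ (X : Scheme.{0}) (f : X ⟶ Spec (.of (ZMod p))), IsSeparated f →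
        LocallyOfFiniteType f → QuasiCompact f → IsIntegral X →
          ∀ x : X, ∃ U : X.Opens, x ∈ U ∧ Scheme.HasResolution (U : Scheme.{0}) :=
  fun hloc => h fun p hp Y f hs hl hq hi _ _ _ _ _ _ => hloc p hp Y f hs hl hq hi _

/-- A refutation of the crux refutes the route target. [folklore] -/
theorem not_primeFieldThesis_of_not_productDescent (h : ¬ ProductDescent) : ¬ PrimeFieldThesis :=
  fun hT => h fun p hp Y f hs hl hq hi _ _ _ _ _ _ =>
    ⟨⊤, trivial, (hT p hp Y f hs hl hq hi).restrict ⊤⟩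

/-- … and the summit. [folklore] -/
theorem not_summit_of_not_productDescent (h : ¬ ProductDescent) :
    ¬ _root_.ResolutionOfSingularities := by
  intro hS
  refine not_primeFieldThesis_of_not_productDescent h fun p hp X f hs hl hq hi => ?_
  haveI : Fact p.Prime := ⟨hp⟩
  haveI := hi
  exact hS p hp (ZMod p) X f hs hl hq inferInstance

/-! ## §2 Degenerate instances hold outright (no junk instance decides the crux) -/

/-- `s = 0`: `𝔸⁰_Y → Y` is an isomorphism, so UPSTAIRS(w) is DOWNSTAIRS(y) — for every scheme
`Y`, with no hypothesis at all. [folklore] -/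
theorem downstairs_of_fin_zero (Y : Scheme.{0}) (W : Scheme.{0}) (j : W ⟶ AffineSpace (Fin 0) Y)
    [IsOpenImmersion j] (w : W)
    (hw : ∃ W' : W.Opens, w ∈ W' ∧ Scheme.HasResolution (W' : Scheme.{0})) :
    ∃ U : Y.Opens, (CategoryTheory.over (AffineSpace (Fin 0) Y) Y).base (j.base w) ∈ U ∧
      Scheme.HasResolution (U : Scheme.{0}) := by
  obtain ⟨W', hw, hres⟩ := hw
  let ι' : (W' : Scheme.{0}) ⟶ Y := W'.ι ≫ j ≫ (CategoryTheory.over (AffineSpace (Fin 0) Y) Y)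
  haveI : IsOpenImmersion ι' := inferInstanceAs (IsOpenImmersion (W'.ι ≫ j ≫ _))
  refine ⟨ι'.opensRange, ⟨⟨w, hw⟩, ?_⟩, Scheme.HasResolution.of_iso ι'.isoOpensRange.hom hres⟩
  simp [ι']

/-- Regular points (in particular the generic point) hold outright: the regular locus of a
scheme locally of finite type over a field is open and is its own resolution.
[cite: Matsumura1987, Cor. to Thm. 30.5] -/
theorem downstairs_of_isRegularLocalRing {p : ℕ} {Y : Scheme.{0}}
    (f : Y ⟶ Spec (.of (ZMod p))) [LocallyOfFiniteType f] [Fact p.Prime] (y : Y)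
    (hy : IsRegularLocalRing (Y.presheaf.stalk y)) :
    ∃ U : Y.Opens, y ∈ U ∧ Scheme.HasResolution (U : Scheme.{0}) := by
  let U : Y.Opens := ⟨Scheme.regularLocus Y, isOpen_regularLocus_of_locallyOfFiniteType_field f⟩
  refine ⟨U, hy, Scheme.IsRegular.hasResolution ?_⟩
  intro x
  have hx : IsRegularLocalRing (Y.presheaf.stalk (U.ι.base x)) := x.2
  exact IsRegularLocalRing.of_ringEquiv (asIso (U.ι.stalkMap x)).commRingCatIsoToRingEquiv

/-! ## §3 Line `birth` (rev L5): the registered stub `stub_sliceWiggle` is false as stated -/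

/-- At `V₁ = ⊥` the conclusion of `stub_sliceWiggle` fails for every `p, Y, s, V, y, g, X₁, π`:
an open `Ω ≤ ⊥` is empty but must contain the section value at the generic point, which lies
in every open `V' ∋ y`. [folklore] -/
theorem sliceWiggle_conclusion_false_of_bot (p : ℕ) (Y : Scheme.{0}) [IsIntegral Y] (s : ℕ)
    (X₁ : Scheme.{0}) (π : X₁ ⟶ ((⊥ : (AffineSpace (Fin s) Y).Opens) : Scheme.{0}))
    (V : Y.Opens) (y : Y) (hyV : y ∈ V) (g : Fin s → Γ((V : Scheme.{0}), ⊤)) :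
    ¬ ∃ (V' : Y.Opens) (hyV' : y ∈ V') (g' : Fin s → Γ((V' : Scheme.{0}), ⊤)),
        (AffineSpace.homOfVector V'.ι (fun i => g' i ^ p)).base ⟨y, hyV'⟩ =
          (AffineSpace.homOfVector V.ι (fun i => g i ^ p)).base ⟨y, hyV⟩ ∧
        ∃ Ω : (AffineSpace (Fin s) Y).Opens, Ω ≤ ⊥ ∧
          IsIso (π ∣_ ((⊥ : (AffineSpace (Fin s) Y).Opens).ι ⁻¹ᵁ Ω)) ∧
          ∀ x : (V' : Scheme.{0}), V'.ι.base x = genericPoint Y →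
            (AffineSpace.homOfVector V'.ι (fun i => g' i ^ p)).base x ∈ Ω := by
  rintro ⟨V', hyV', g', -, Ω, hΩ, -, hgen⟩
  have hηV' : genericPoint Y ∈ V' :=
    ((genericPoint_spec Y).mem_open_set_iff V'.isOpen).mpr ⟨y, trivial, hyV'⟩
  exact (TopologicalSpace.Opens.mem_bot).mp (hΩ (hgen ⟨genericPoint Y, hηV'⟩ rfl))

/-- **`stub_sliceWiggle` (registered signature, negated verbatim) is false.** Witness at any
prime: `Y = Spec 𝔽_p[X]`, `y = (X) ≠ η`, `s = 0`, `V₁ = ⊥`, `X₁ = ↑⊥`, `π = 𝟙`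
(`IsBirational (𝟙 ↑⊥)` holds: `U = ⊤` is dense with dense preimage and `𝟙 ∣_ ⊤` is an iso).
CLASS misstated. REPAIR: insert `(AffineSpace.homOfVector V.ι (fun i => g i ^ p)).base ⟨y, hyV⟩ ∈ V₁ →`
after `∀ g …,`; then (paper) `Ω :=` image of the dense iso-locus of `π` is a non-empty open of
`𝔸ˢ_Y`, its generic fibre `Ω_K ⊆ 𝔸ˢ_K` is a non-empty open, `y ≠ η` gives `𝔪_{Y,y} ≠ 0`
infinite, and `F(gᵖ + uᵖ) ≠ 0` (`F ≠ 0` vanishing off `Ω_K`) has a non-root `h ∈ 𝔪_{Y,y}ˢ`;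
`g' := g + h` on a neighbourhood `V'`. Landed as
`Theorems.ProductDescent.Negative.stub_sliceWiggle_false` (p153659). [folklore] -/
theorem stub_sliceWiggle_false :
    ¬ ∀ p : ℕ, p.Prime → ∀ (Y : Scheme.{0}) [IsIntegral Y] (s : ℕ)
      (V₁ : (AffineSpace (Fin s) Y).Opens)
      (X₁ : Scheme.{0}) (π : X₁ ⟶ (V₁ : Scheme.{0})), IsBirational π →
      ∀ (V : Y.Opens) (y : Y) (hyV : y ∈ V), y ≠ genericPoint Y →
      ∀ g : Fin s → Γ((V : Scheme.{0}), ⊤),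
      ∃ (V' : Y.Opens) (hyV' : y ∈ V') (g' : Fin s → Γ((V' : Scheme.{0}), ⊤)),
        (AffineSpace.homOfVector V'.ι (fun i => g' i ^ p)).base ⟨y, hyV'⟩ =
          (AffineSpace.homOfVector V.ι (fun i => g i ^ p)).base ⟨y, hyV⟩ ∧
        ∃ Ω : (AffineSpace (Fin s) Y).Opens, Ω ≤ V₁ ∧ IsIso (π ∣_ (V₁.ι ⁻¹ᵁ Ω)) ∧
          ∀ x : (V' : Scheme.{0}), V'.ι.base x = genericPoint Y →
            (AffineSpace.homOfVector V'.ι (fun i => g' i ^ p)).base x ∈ Ω := by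
  intro h
  haveI : Fact (Nat.Prime 2) := ⟨Nat.prime_two⟩
  let Y : Scheme.{0} := Spec (.of (Polynomial (ZMod 2)))
  have hprime : (Ideal.span {(Polynomial.X : Polynomial (ZMod 2))}).IsPrime := by
    rw [Ideal.span_singleton_prime Polynomial.X_ne_zero]
    exact Polynomial.prime_X
  let y : Y := (⟨Ideal.span {Polynomial.X}, hprime⟩ : PrimeSpectrum (Polynomial (ZMod 2)))
  have hy : y ≠ genericPoint Y := by
    intro hyη
    have h1 : y.asIdeal = (⊥ : Ideal (Polynomial (ZMod 2))) := by
      rw [hyη]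
      exact congrArg PrimeSpectrum.asIdeal (genericPoint_eq_bot_of_affine _)
    have h2 : (Polynomial.X : Polynomial (ZMod 2)) ∈ y.asIdeal := Ideal.subset_span rfl
    rw [h1, Ideal.mem_bot] at h2
    exact Polynomial.X_ne_zero h2
  have hbir : IsBirational (𝟙 (((⊥ : (AffineSpace (Fin 0) Y).Opens) : Scheme.{0}))) :=
    ⟨⊤, by simp [dense_univ], by simp [dense_univ], inferInstance⟩
  exact sliceWiggle_conclusion_false_of_bot 2 Y 0 _ (𝟙 _) ⊤ y trivial (fun _ => 0)
    (h 2 Nat.prime_two Y 0 ⊥ _ (𝟙 _) hbir ⊤ y trivial hy (fun _ => 0))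

/-! ## §4 Targets / line switch to `vertical-lines` (lead, ~10:45Z; rev VL2)

No stuck stubs were handed to this seat (`targets = []`); the `birth` stub kill above was found
by the degenerate-instance sweep over all six rev-L5 stubs (the lead independently corrected the
stub, all `birth` stubs have landed, `stub_separabilisation` was PROMOTED and `birth` parked).

LINE `vertical-lines` (`Lines/vertical_lines.lean`, rev VL2: `stub_affineInduction` p155056 and
`stub_resolutionOfFlatCharts` p155001 landed; the only `sorry` is `stub_verticalLines`). Audit:

* `stub_affineInduction`, `stub_resolutionOfFlatCharts` — true (landed). Degenerate probes of the
  latter: `U' = ∅` impossible (`g` birational onto `X ∋ x`), empty charts impossible (`v : V`);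
  no hypothesis on `X` beyond `LocallyOfFiniteType` is needed (flat descent of regularity +
  openness of `Reg U'` + `g` closed) — consistent with the statement.
* `stub_verticalLines` — SUBSTANTIVE and, unlike every other statement of this crux, NOT implied
  by the summit: it constrains the GIVEN resolution `Z`. Two reductions any attack should use:
  (R1) a flat chart `a : V → U'` at `v` with `V ⊆ Z` regular forces `𝒪_{U',a v}` regular
  (Matsumura 23.7 (i)) and reduced, so WLOG (shrinking `U`) `g : U' → U` is a RESOLUTION of a
  neighbourhood of `y` — the stub says "some resolution of `(Y, y)` is swept, along its fibre
  over `y`, by flat germs of the given `Z`"; in particular it implies DOWNSTAIRS(y) outright and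
  can only be refuted at a point `y` that HAS resolvable neighbourhoods (e.g. `Y` regular!).
  (R2) `a` is the unique extension of the rational map `Z ⇢ U'` (`g` separated birational, `Z`
  reduced), and for `Z`, `U'` regular, `a` is flat at `v` iff `dim_v a⁻¹(a v) = dim Z - dim U' = 1`.
  So the stub ⟺ ∃ resolution `U' → U ∋ y` such that every `u' ∈ g⁻¹(y)` has a "private point":
  `v ∈ Dom(Z ⇢ U')` over `u'` with 1-dimensional fibre there.
  Degenerate regimes hold: `dim Y = 0` (`U' = U = pt`, everything flat over a field, the two maps
  to `Spec 𝔽_p` agree); `dim Y = 1` (`U' = U` near `y` by (R1)+normality; `φ : Z → Y` is flat,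
  `Z` integral dominating a Dedekind germ, and surjective near `y`).
  Paper search for a pathological `Z` over REGULAR `Y = 𝔸²`, `y = 0`, `W' = 𝔸³` (char-free; the
  line card's cheapest falsifier), all flattened WITH private points by the matching tower of
  point blow-ups of `𝔸²` — computations kept in the seat's NOTES.md §vertical-lines:
    `Z = 𝔸³` (φ flat, `g = 𝟙`); `Bl_P 𝔸³` (limit curves `L̃ ∪ M_λ`, meridians through the pole
    `N ∈ E_P = ℙ²`, `Ind(Z ⇢ Bl_0 𝔸²) = L̃`, private points `M_λ ∖ N`); `Bl_L 𝔸³ = Bl_0 𝔸² × 𝔸¹`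
    (flat over `Bl_0 𝔸²`); `Bl_C Bl_L 𝔸³` for `C ⊂ E_L = F × 𝔸¹` horizontal (incl. the `birth`
    killer `C = {λᵖ = t}`: fibres `ℓ̃_λ ∪ ℙ¹_{Q_λ}`, dimension 1, hence FLAT over `Bl_0 𝔸²`);
    `C = ℓ_{λ₀}` vertical (`Z = Bl_{λ₀} Bl_0 𝔸² × 𝔸¹`); `Bl_P Bl_L`, `Bl_{L̃} Bl_P ≅ Bl_{F₀} Bl_L`;
    and the designed candidate `Z₄ = Bl_D Bl_{ℓ̃} Bl_{F₀} Bl_L 𝔸³` (`F₀ = F × {0}`,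
    `ℓ = {λ₀} × 𝔸¹`, `D` = strict transform of the `ℙ¹`-fibre of `E_{F₀}` over `Q = ℓ ∩ F₀`, blown
    up precisely to destroy the private points of `λ₀` for `g₁ = Bl_0`): chart computation
    (`a = t a'`, `b = a' b'`; `I_ℓ·𝒪 = a'·(t, b')`, principalised by `Bl_D`) shows
    `Dom(Z₄ ⇢ Bl_{λ₀} Bl_0 𝔸²) = Z₄` with fibres over the new exceptional curve `F₂` of
    dimension 1 (`{t'' = c} ∩ ({a' = 0} ∪ {b' = 0})`), i.e. `g₂ = Bl_{λ₀} Bl_0` flattens `Z₄` with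
    private points everywhere. MORAL (evidence FOR the principle when `Y` is a regular surface):
    removing the private points of a level-`n` limit curve requires blowing up that whole curve,
    which principalises the level-`(n+1)` ideal; `Z` has finitely many exceptional components, so
    the tower of point blow-ups catches up. Not a proof.
  Mechanisms that COULD still kill it (targets for a later cycle / for the lead's analysis):
  (M1) a limit curve `Λ_{u*}` of the minimal flattener `U*` entirely contained in
  `Ind(Z ⇢ U*)` (a closed subset of `Z_y` of codimension ≥ 2 in `Z`: `Z* → Z` is an isomorphism
  over every codimension-1 point because `Z` is regular, so through a general point of each
  surface component of `Z_y` passes exactly ONE limit curve — no "envelopes"; a base CURVE of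
  the family of limit curves is the thing to engineer); (M2) a minimal flattener `U*` that is
  SINGULAR at a point of its fibre over `y` (then by (R1) no flat chart exists onto `U*` there,
  and every regular `U'` must be tested separately); (M3) `dim Y ≥ 3` regular, where
  modifications are no longer towers of point blow-ups, or a singular surface germ `(U, y)` with
  `Z` not dominating `U_min × 𝔸¹` (small-resolution phenomena, cf. the line card's 3-fold node).
  No counterexample in print found this cycle (no search run beyond the tree; `lit` budget kept
  for cycle 2 if re-armed on this line). -/

/-! ## §4b (cycle 2) `stub_verticalLines` is FALSE on paper — witness `Z = Bl_C Bl_L 𝔸⁴` over `Y = 𝔸³`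

Full proof: `stubs/StubVerticalLines.md` (evidence on the item). Summary: `L = {y} × 𝔸¹`,
`C₀ = {u₃ = 0, u₂ = t·u₁²} ⊃ L` (smooth, non-vertical), `Z₁ = Bl_L 𝔸⁴`, `C` = strict transform of `C₀`
(smooth, `C ∩ E_L = ℓ_{e₁}`), `Z = Bl_C Z₁` — a resolution of `W' = 𝔸⁴` modifying the whole vertical line.
The flat limit of the vertical lines along the arc `γ_{α,β}(s) = (s, αs², βs²)` (`β ≠ 0`) is the single
reduced curve `T_{α,β} = {f = β/(α − t)}` in the exceptional surface `Σ = F|_ℓ` (coordinates `(t, f)`):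
a TWO-parameter family of pairwise distinct curves on ONE surface. LEMMA (flat charts see flat limits): a
flat `a : V → U'` compatible with `φ` has `a⁻¹(γ̃(0)) ⊆ (flat limit along γ) ∩ V` for every arc lifted
through the iso locus of `g`. Hence a flat-chart point `v` for `u'₀ = γ̃_{α₀,β₀}(0)` lies on `T_{α₀,β₀}` with
infinite fibre `a⁻¹(u'₀)` (flat, `dim Z = 4 > 3 ≥ dim U'`); if another good arc has the same limit point
the infinite fibre sits in `T₀ ∩ T₁` (finite) — contradiction; if not, the infinitely many tails through
the closed point `v` force `a(v) = γ̃_{α,β}(0) ≠ u'₀` (two morphisms from the reduced lifted surface to the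
separated `U'` agreeing on a dense open) — contradiction. So NO `(U, U', g)` works; `dim Y = 3` is the
first dimension where second-order data of arcs (2 parameters) overfills the receiving surface. The crux is
untouched (`Y` regular); the line card's FALLBACK (regular points of the flattened strict transform `Z*`
over `U* = Bl_{[e₁]} Bl_0 𝔸³`, fibres `T_{α,β} ≅ 𝔸¹`) survives this witness. The chart identities, over any
field: -/

section VerticalLinesWitness

variable {K : Type*} [Field K]

/-- Strict transform of `C₀ = {u₃ = 0, u₂ = t u₁²}` in the chart `u₂ = u₁ m₂`, `u₃ = u₁ m₃` of `Bl_L 𝔸⁴`: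
`C = {m₃ = 0, m₂ = t u₁}`. [folklore] -/
example (u₁ m₂ m₃ t : K) (hu : u₁ ≠ 0) :
    (u₁ * m₃ = 0 ∧ u₁ * m₂ = t * u₁ ^ 2) ↔ (m₃ = 0 ∧ m₂ = t * u₁) := by
  constructor
  · rintro ⟨h3, h2⟩
    refine ⟨(mul_eq_zero.mp h3).resolve_left hu, mul_left_cancel₀ hu ?_⟩
    rw [h2]; ring
  · rintro ⟨h3, h2⟩
    exact ⟨by rw [h3, mul_zero], by rw [h2]; ring⟩

/-- The lifted vertical surface over the arc `(s, α s², β s²)` is `{m₂ = α u₁, m₃ = β u₁}` (`u₁ = s`).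
[folklore] -/
example (s α β m₂ m₃ : K) (hs : s ≠ 0) (h2 : s * m₂ = α * s ^ 2) (h3 : s * m₃ = β * s ^ 2) :
    m₂ = α * s ∧ m₃ = β * s :=
  ⟨mul_left_cancel₀ hs (by rw [h2]; ring), mul_left_cancel₀ hs (by rw [h3]; ring)⟩

/-- The blow-up coordinate `f = m₃ / (m₂ − t u₁)` of `Bl_C` restricted to that surface is `β/(α − t)`:
`u₁` CANCELS, so the flat limit `u₁ → 0` is the graph `f = β/(α − t)` inside `Σ`. [folklore] -/
example (u₁ α β t : K) (hu : u₁ ≠ 0) :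
    (β * u₁) / (α * u₁ - t * u₁) = β / (α - t) := by
  rw [show α * u₁ - t * u₁ = u₁ * (α - t) by ring, mul_comm β u₁, mul_div_mul_left _ _ hu]

/-- Two tails `f = β/(α − t)`, `f = β'/(α' − t)` (`β ≠ 0`) agreeing at two parameters coincide: distinct
good arcs have distinct limit curves, meeting in finitely many points. [folklore] -/
example (α β α' β' t₁ t₂ : K) (ht : t₁ ≠ t₂) (hβ : β ≠ 0)
    (h₁ : β * (α' - t₁) = β' * (α - t₁)) (h₂ : β * (α' - t₂) = β' * (α - t₂)) :
    α = α' ∧ β = β' := by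
  have hb : (β - β') * (t₂ - t₁) = 0 := by linear_combination h₁ - h₂
  have hββ' : β = β' := by
    rcases mul_eq_zero.mp hb with h | h
    · exact sub_eq_zero.mp h
    · exact absurd (sub_eq_zero.mp h) (Ne.symm ht)
  subst hββ'
  have ha : β * (α' - α) = 0 := by linear_combination h₁
  rcases mul_eq_zero.mp ha with h | h
  · exact absurd h hβ
  · exact ⟨(sub_eq_zero.mp h).symm, rfl⟩

/-- Through every point `(t₀, f₀)` of `Σ` passes the one-parameter family of tails `β = f₀ (α − t₀)`,
`α ≠ t₀`: no point of any tail is private. [folklore] -/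
example (α t₀ f₀ : K) (hα : α - t₀ ≠ 0) : (f₀ * (α - t₀)) / (α - t₀) = f₀ :=
  mul_div_cancel_right₀ f₀ hα

end VerticalLinesWitness


/-! ## §4c (cycle 3) The lead's witness `Z = Bl_C Bl_ℓ 𝔸⁴` (rotating pencil) — kernel-checked core

`Lines/vertical-lines-dead.md` (lead c1, 11:35Z) kills `stub_verticalLines` a second time, over the
same regular `Y = 𝔸³`, with the pencil `C = {a = t·b} ⊂ G × 𝔸¹` of lines through `P = [0:0:1] ∈ G`
(`G = Exc(Bl_y 𝔸³)`), and proves MORE than §4b: by CHART RIGIDITY (its F5: a flat `φ`-compatible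
chart at `v` has ring `a^*(𝒪_{U',u'}) = 𝒪_{Z,v} ∩ k(U)`, faithful flatness) the admissible chart
rings are exactly `𝒪_{Bl_y 𝔸³, x}`, `x ∈ G ∖ {P}`, so for EVERY proper birational `U' → U ∋ y` the
fibre `g⁻¹(y)` would be a non-empty open of `ℙ²` missing `P` — against properness. The two facts of
that proof that are pure commutative algebra are its F3 ("over `Π = E_C|_{P × 𝔸¹}` the pulled-back
centre ideal `(α̂, β̂, c)·𝒪_Z` is the ideal `I_Π` of a smooth SURFACE, so `𝒪_{B,P} → 𝒪_{Z,v}` has a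
2-dimensional fibre and is not flat") in the two charts of `Bl_C`; they are checked here over an
arbitrary commutative ring (chart (i'): `a = (ŝ + tβ̂)ŝc̃`, `b = β̂ŝc̃`, `c = ŝc̃`, so
`(α̂, β̂, c) = (ŝ + tβ̂, β̂, ŝc̃)`; chart (ii'): `(α̂, β̂, c) = (cś + tβ̂, β̂, c)`). The SAME identity is
what makes the card's fallback survive this witness: `𝔪_P·𝒪_{Z̄} = I_{Π̄}` is the ideal of a smooth
surface, so `Bl_P` downstairs is matched by the regular `Bl_{Π̄} Z̄` upstairs (dead.md §5). -/

section PencilWitness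

variable {R : Type*} [CommRing R]

/-- F3, chart (i') of `Lines/vertical-lines-dead.md`: `(ŝ + t β̂, β̂, ŝ c̃) = (ŝ, β̂)` as ideals —
the pulled-back ideal of the point `P` is the ideal of the surface `Π = {ŝ = β̂ = 0}`. [folklore] -/
theorem span_pencilChart_i (s b c t : R) :
    Ideal.span ({s + t * b, b, s * c} : Set R) = Ideal.span {s, b} := by
  apply le_antisymm
  · rw [Ideal.span_le]
    rintro x (rfl | rfl | rfl)
    · exact Ideal.add_mem _ (Ideal.subset_span (by simp))
        (Ideal.mul_mem_left _ _ (Ideal.subset_span (by simp)))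
    · exact Ideal.subset_span (by simp)
    · exact Ideal.mul_mem_right _ _ (Ideal.subset_span (by simp))
  · rw [Ideal.span_le]
    rintro x (rfl | rfl)
    · have h : (x + t * b) - t * b ∈ Ideal.span ({x + t * b, b, x * c} : Set R) :=
        Ideal.sub_mem _ (Ideal.subset_span (by simp))
          (Ideal.mul_mem_left _ _ (Ideal.subset_span (by simp)))
      simpa using h
    · exact Ideal.subset_span (by simp)

/-- F3, chart (ii'): `(c ś + t β̂, β̂, c) = (c, β̂)` — again the ideal of the surface
`Π = {c = β̂ = 0}`; so in both charts `𝒪_{Z,v}/(α̂, β̂, c)` is the local ring of a SURFACE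
(`k[c̃,t]` resp. `k[ś,t]` localised): fibre dimension `2 ≠ dim 𝒪_{Z,v} − dim 𝒪_{B,P} = 1`, hence
`𝒪_{B,P} → 𝒪_{Z,v}` is not flat (Matsumura 15.1). [folklore] -/
theorem span_pencilChart_ii (s' b c t : R) :
    Ideal.span ({c * s' + t * b, b, c} : Set R) = Ideal.span {c, b} := by
  apply le_antisymm
  · rw [Ideal.span_le]
    rintro x (rfl | rfl | rfl)
    · exact Ideal.add_mem _ (Ideal.mul_mem_right _ _ (Ideal.subset_span (by simp)))
        (Ideal.mul_mem_left _ _ (Ideal.subset_span (by simp)))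
    · exact Ideal.subset_span (by simp)
    · exact Ideal.subset_span (by simp)
  · rw [Ideal.span_le]
    rintro x (rfl | rfl)
    · exact Ideal.subset_span (by simp)
    · exact Ideal.subset_span (by simp)

/-- F2 of the same note (flat points): off `Π`, over `x = [t₀ : 1 : γ₀] ∈ G ∖ {P}`, chart (i)
(`b = s b̃`, `α = s + t`): the fibre ideal `(α − t₀, b, γ − γ₀) = (s + t − t₀, s b̃, γ − γ₀)` cuts the
4-space down to the CURVE `{s b̃ = 0}` (two lines) — dimension `1 = 4 − 3`, so there the chart IS
flat (regular source and target, Matsumura 23.1). The identity used: modulo `s + (t − t₀)` the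
generator `s b̃` becomes `−(t − t₀) b̃`. [folklore] -/
example (s bt t t₀ : R) (h : s + (t - t₀) = 0) : s * bt = -((t - t₀) * bt) := by
  have hs : s = -(t - t₀) := by linear_combination h
  rw [hs]; ring

end PencilWitness

/-! ## §5 (cycle 3, 2026-08-17 ~12:30Z) After both lines: what is refutable, what is not, and the
gauntlet for the next lines

STATE. `birth` parked (its promoted core `stub_separabilisation` ⟸ DOWNSTAIRS(y): no slack, §3 and
`Negative/SeparabilisationNoSlack.lean` p155579); `vertical-lines` DEAD (`stub_verticalLines` false:
§4b and §4c, two independent witnesses over the regular `Y = 𝔸³`; `Lines/vertical-lines-dead.md`);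
the lead's `KERNEL.md` reduces the crux to (K) = descent of existence of LOCAL resolutions along
`k → k(t)` and lists three residues. This section is the disprover's brief for the re-ideation.

### 5a. What can and cannot be refuted (numbers, not hopes)
* The crux, (K), the route target and every statement of the shape "some open / some model of an
  integral finite-type `𝔽_p`-scheme has a resolution" are implied by `PrimeFieldThesis` (§1): NOT
  refutable below the summit. This includes the `vertical-lines` FALLBACK in its existential form
  FB := "for the given `Z → W' ⊆ 𝔸¹_U` there are a proper birational `g : U' → U ∋ y` and a closed
  `Z' ⊆ Z ×_U U'`, flat over `U'` and equal to `Z` over the generic point, with a REGULAR point of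
  `Z'` on every fibre over `y`". Proof that `PrimeFieldThesis ⇒ FB` (paper, each step standard):
  compactify `Z ⊆ Z̄ → U × ℙ¹` (Nagata; `Z̄|_{W'} = Z` since `Z → W'` is proper and `Z̄` integral);
  let `U^H` be the closure of `U ∖ {y}` in `Hilb(Z̄/U)` and `Z^H → U^H` the universal family = the
  strict transform (flat over an integral base ⇒ no vertical components); RESOLVE `U^H` (an integral
  separated finite-type `𝔽_p`-scheme — this is where the target is used; pointwise local
  resolvability is not enough, the whole proper fibre `U^H_y` must be covered): `U'' → U^H`, and
  `Z'' := Z^H ×_{U^H} U''` is flat over the regular `U''` and is again the strict transform; for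
  `u'' ∈ U''_y` the fibre `Λ = Z''_{u''}` pushes forward to the cycle `[{y} × ℙ¹]` (proper
  push-forward commutes with specialisation of cycles: Fulton, Intersection Theory, §10.1/§20.3),
  so `Λ` has exactly one component `H` dominating `ℙ¹`, with multiplicity one; at its generic
  point `ξ'` the closed fibre of the flat
  local map `𝒪_{U'',u''} → 𝒪_{Z'',ξ'}` is the field `𝒪_{Λ,ξ'}`, so `𝒪_{Z'',ξ'}` is regular
  (Matsumura 23.7 (ii)); and `ξ' ∈ Z` (it lies over the generic point `λ` of the vertical line,
  `λ ∈ W'`). Conversely FB ⇒ DOWNSTAIRS(y) by the landed `stub_resolutionOfFlatCharts` (p155001).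
  So FB is sandwiched `PrimeFieldThesis ⇒ FB ⇒ crux-conclusion`: crux-sized, irrefutable, as the
  lead said — do not make it a stub hoping the disprover can test it.
* REFUTABLE are only statements constraining the GIVEN resolution `Z` (transport mechanisms) or
  naming a SPECIFIC downstairs model. For flatteners the dichotomy is sharp: for ANY flattener `U'`
  of `φ : Z̄ → U` with flat strict transform `Z'` and any `u' ∈ U'_y`,
      `𝒪_{U',u'}` regular ⟺ `Z'` has a regular point over `u'` ⟺ `Z'` is regular at the generic
      point of the multiplicity-one horizontal component of `Z'_{u'}`
  (⇐ Matsumura 23.7 (i); ⇒ 23.7 (ii) as above). Hence the only refutable residue of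
  `vertical-lines` is the ENGINE "the Hilbert flattener `U^H` (or its normalisation `U*`, the
  minimal flattener) is REGULAR along its `y`-fibre whenever `Z̄` is regular" (KERNEL §3.1 = M2 of
  §4). It is not typable in the tree today (no Hilbert schemes; `Stacks081R` + `blowupStrictTransform`
  type only the existential FB), and I have NO counterexample to it: see 5c.

### 5b. The gauntlet: six witnesses every transport stub must survive (all on file, all cheap)
A stub that extracts a `k`-structure from the given `Z` (slice, section, chart, flattener, dominating
model, specialisation `t ↦ a`) should be evaluated by its author on:
* W1 `Z = Bl_ℓ 𝔸ⁿ⁺¹ = Bl_y 𝔸ⁿ × 𝔸¹` (`ℓ` the vertical line; benign baseline — everything is flat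
  over `Bl_y 𝔸ⁿ`; a stub failing here is mis-typed).
* W2 INSEPARABLE STRATA (planner's example, §5-old/finding 5; barrier `InseparableBaseChange`): inside a
  resolution over a singular `y`, blow up `{t = uᵖ} ⊂ E × 𝔸¹` (`E` exceptional over `y`): every
  constant slice `t = a`, `a ∈ 𝔽̄_p`, acquires `w·v + (u − a^{1/p})ᵖ = 0`. Kills: constant slices,
  specialisation of the generic fibre without re-resolution (`birth`'s `stub_goodSpecialisation`),
  anything needing the smooth locus of `Z → 𝔸¹` to meet every component over `y`.
* W3 (§4b) `Z = Bl_C Bl_L 𝔸⁴`, `C₀ = {u₃ = 0, u₂ = t u₁²}` over `Y = 𝔸³`: a 2-parameter family of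
  limit tails `f = β/(α − t)` on ONE exceptional surface. Kills: flat charts from `Z` (private
  points), "every limit curve has a point through which only finitely many limit curves pass".
* W4 (§4c, dead.md) `Z = Bl_C Bl_ℓ 𝔸⁴`, `C = {a = t b}` the rotating pencil through `P ∈ G`: the
  centre over `y_{k(t)}` is `k(t)`-rational but not `k`-definable and passes through a `k`-point.
  Kills: flat charts onto ANY modification (chart rigidity), "dominate `Z_{k(t)}` by the base change
  of a `k`-model" (`Bl_P B`, `Bl_{curve ∋ P} B` are not reached by `Z ⇢ U'`; `B = Bl_y 𝔸³` is
  reached but not flatly), and it is DIMENSION-SHARP (`dim Y = 2`: `stub_verticalLines` true —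
  resolutions of 2-dimensional regular germs factor into closed-point blow-ups, the constant
  sub-tower descends; dead.md §4) and PRODUCT-STABLE (`Z × 𝔸ᵐ` over `𝔸³⁺ᵐ` is again a witness,
  dead.md §4), so "assume `dim Y ≥ 4`" rescues nothing.
* W5 (line card `Lines/vertical-lines.md`) the twisted product over the 3-fold node
  `Bl_S(U × 𝔸¹)`, `S` a rotating plane: the minimal flattener is the SMALL resolution of the node
  (card's computation, not re-checked here). Kills: "the descended model is a composite of blow-ups
  of `y` and of smooth centres over `y`", "the descended model dominates `Bl_y U`" (`𝔪_y` pulls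
  back to the ideal of the exceptional `ℙ¹`, not invertible).
* W6 FINITE RESIDUE FIELD (STRATEGY-CENSUS (iii) S_b; rattack): `κ(y) = 𝔽_q` and the resolvable
  locus `W'_y ⊆ 𝔸¹_{𝔽_q}` need not have an `𝔽_q`-point (translations/scalings of `𝔸¹_U` permute
  rational points, so it cannot be moved onto one). Kills: every stub needing a `κ(y)`-rational
  point of the resolvable vertical fibre or a section `U → W'` through `w` without a finite étale
  base change — and the base change re-imports Galois descent of existence-only resolutions
  (`birth`'s blocked `stub_finiteFieldDescent`).
Hypothesis drops remain VACUOUS (§1, finding 4): no witness exists with `Y` non-reduced at `y`,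
non-Noetherian, or a Nagata-bad curve, because UPSTAIRS fails there too.

### 5c. M2 (singular canonical flattener) — searched, not found; one trap recorded
Target: a REGULAR `Z̄ → U × ℙ¹` (modification, `U` regular of small dimension) whose normalised
Hilbert flattener `U*` is SINGULAR at a point over `y` (equivalently, by 5a: whose flat strict
transform `Z*` is singular along an entire fibre). Findings (paper, this cycle; details in the
seat's NOTES.md §M2):
* STRUCTURE IN `dim U = 2`. `U*` dominates the constant sub-tower surface `U♮` (the tower of
  closed-point blow-ups of `U_{k(t)}` at constant centres, descended; dead.md §4): the horizontal
  generic point of the limit curve over `u* ∈ U*` is the centre on `Z_{k(t)}` of the CONSTANT arcs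
  through the image `u' ∈ U♮`, and `U* ⇢ U♮` is a bijective-on-fibres graph closure onto a normal
  base, hence a morphism. The local rings of `Z̄` at horizontal generic points are the Gauss
  extensions `𝒪_{U♮,u'}(t)`; consequently `Z* → U*` is automatically flat at horizontal generic
  points and `U*` is regular at every point where `U* → U♮` is a local isomorphism: singular points
  of `U*` can only sit on curves CONTRACTED onto `U♮`, i.e. come from TAILS (vertical data at closed
  points `t = a`).
* TRAP (equidimensional ≠ flat; cycles ≠ schemes). `Z̄ = Bl_Q Bl_{D₁} 𝔸³` over `U = 𝔸²_{x,y}`,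
  `D₁ = {y = t = 0}` (the `x`-axis at height `0`), `Q` = the point where the strict transform of
  the vertical line over `0` meets the ruling `f₀` of `E_{D₁}` (toric: fan `e₁,e₂,e₃,(0,1,1),(1,2,1)`,
  all four cones unimodular). Limit CYCLES over `0`: every arc transversal to the `x`-axis gives
  `Ṽ₀ + f̃₀ + 2M₀` (`M₀` the line `{x = 0}` of `E_Q ≅ ℙ²`), arcs `y = μx² + …` give
  `Ṽ₀ + f̃₀ + K_μ` with `K_μ = {y₁t = μx²}` the pencil of conics, `K_∞ = 2M₀`: at the level of
  cycles (and of the toric "fibre fan", rays `(1,0),(1,2),(0,1)`) the flattener is the weighted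
  blow-up `Bl_{(y,x²)} 𝔸²`, which has an `A₁` point. But the limit SCHEMES remember the direction:
  along the arc `(as, bs)` the cylinder transform is `T = {x₂ = (a/b)·y₂t}` (chart `x = t x₂`,
  `y₁ = t y₂`) and the limit is `(x₂ − (a/b)y₂t, y₂t²)`, whose double structure
  `(x₂ − (a/b)y₂t, t²)` on `M₀` depends on `a/b` (and on nothing else: every such structure contains
  `(x₂,t)²`, which swallows the higher jets of the arc). So `U^H` separates directions, the
  singular surface is NOT a flattener (the strict transform over its `A₁` point cannot be flat,
  else all transversal arcs would share one limit scheme), and `U*` is the REGULAR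
  `Bl_{q₁} Bl_0 𝔸²` (limit schemes ↔ its points: the double structures along `E₁`, the conics
  `K_μ` along `E₂`, meeting at the planar double line `(x₂², t)`). Moral for anyone computing
  flatteners combinatorially or cycle-theoretically.
* PENCIL MECHANISM (why `dim 2` looks benign; heuristic, for pencil members smooth along the
  tail). For arcs through `u'` in direction `[a:b]` the limit is the divisor `B|_T + F|_T` on the
  strict transform `T_{[a:b]}` of the cylinder (`B` = base scheme of the strict-transform pencil =
  `T ∩ T'` for two general members, `F = Σ ord·E_j` over the exceptional SURFACES `E_j ⊂ φ⁻¹(u')`).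
  A tail `C` common to general directions and lying in some `E_j` has multiplicity
  `μ = i(T,T';C) + mult_C(F|_T) ≥ i(T,T';C) + 1` in the limit, while two smooth members induce the
  same `μ`-fold structure on `C` only if they osculate to order `μ − 1`, i.e. only if
  `i(T,T';C) ≥ μ` — so the multiple structures DIFFER between directions; a direction-dependent
  tail separates directions anyway; and `Λ·E_j = 0` shows that a common limit with no component
  inside `E_j` is DISJOINT from `E_j`. Upshot: general directions through `u'` are lumped only if
  their common limit avoids every exceptional surface over `u'` (in particular `Ṽ` must miss them,
  `Ṽ·E_j = 1` otherwise forcing a tail inside `E_j`) — which is what a singular `U*` would need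
  along a whole contracted curve. Not a proof of regularity in `dim 2`; recorded as the obstruction
  met in three further toy towers (`Bl_{f₀} Bl_{D₁}`: `U* = Bl_0`; `Bl_{Q_c} Bl_{D₁}`, `Q_c ∈ f₀`
  generic: directions separated by the lines `X = (a/b)c₀T ⊂ E_{Q_c}`; NOTES.md §M2).
* `dim U = 3`: in W4 `U^H ≐ Bl_P Bl_y 𝔸³` up to normalisation (dead.md §4), regular. Where a
  witness should be sought: centres `C_{k(t)} ⊂ G_{k(t)}` that are CONICS/cubics through constant
  points degenerating with `t`, so that the forced downstairs centre is a non-reduced point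
  (a weighted blow-up of `Bl_y 𝔸³`), and then the SCHEME structure of the limits must be checked as
  in the trap. Not done: each such computation is a full cycle (cf. dead.md F1–F5), and the target
  is an engine nobody can type yet.

### 5d. Literature (degraded this cycle)
Local `searchd` connection reset; OpenAlex HTTP 429 (daily budget), Semantic Scholar 429; arXiv and
zbMATH API: 0 hits for "resolution of singularities descends smooth morphism existence
non-functorial positive characteristic" / "flattening blow-up regular universal flattening singular
Hilbert scheme flat limits of lines"; `lit galaxy search "platificateur" --star all`: 1 hit (La Rábida
1981 proceedings, LNM 961 — Hironaka-school local flatteners; not about regularity of the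
flattener); `lit galaxy search` bm25 over web PDFs on "product with the affine line admits a
resolution ⇒ the variety does?": 15 hits, none relevant (nearest: Abramovich–Temkin–Włodarczyk,
relative desingularization arXiv:2003.03659 — characteristic 0 and FUNCTORIAL, i.e. Kollár 3.4's
world, STRATEGY-CENSUS §Transfer). The grounders' verdict stands: (K) / the crux is not in print in
either direction. `search-degraded: searchd, openalex, s2` — a later seat should re-run the two
API queries.

## What provers should take from this file (cycle 3 addendum)
* A line's ONLY testable content is its transport mechanism; run it through W1–W6 before filing.
  Both dead lines would have died on paper at W2 resp. W4 within an hour.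
* Do not file FB or (K) as a "stub": they are the crux. If a line wants the flattener route, its
  engine must be the regularity of a CANONICAL flattener (5a), stated for a typable surrogate
  (e.g. "the normalised blow-up of the `d`-th Fitting ideal of `φ_* 𝒪_{Z̄}(n)`"), and it must come
  with a reason; the disprover will then test it on W3/W4-type pencils with degenerate conics (5c).
-/

/-! ## §6 Near-misses
None with a `sorry`: everything attempted either closed (above) or is not statable in the tree
within a cycle (finding 5, the constant-slice strengthening; finding 4, a non-finite-type
witness; §4b/§4c, the scheme-level refutation of `stub_verticalLines` — no blow-up with charts of a
non-affine centre in the tree; §5c, M2). -/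

end Summit.ResolutionOfSingularities.ResolutionOfSingularities.Cruxes.ProductDescent.Disproof

end
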